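import Summits.BirchSwinnertonDyer.Rank1Residual.Additive.KatoDescentKMCImpReadingRowRealizable
import Summits.BirchSwinnertonDyer.BirchSwinnertonDyer.Theorems.InertBadSignedBranchesCccOneLawOnTypeIstarZeroOfBSDpKForm
import Literature.NumberTheory.EllipticCurves.AnalyticRankModularityProofs
import HarnessLib

set_option autoImplicit false

/-!
# Crux 19223 `CccOneLawOnTypeIstarZero` BY NAME from the Kato–Perrin-Riou line ON THE K8 ROUTE'S ITEMS OF RECORD (rev 4):
# the ASIDE item `PrintReadingsInert` (19226) — and with it the retired `ℚ(√p*)`-form plus main conjecture (C1_η)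
# `QuadraticBranchPlusMainConjectureAt` on the CM good-inert twins — LEAVES THE K8 KPR CONE, replaced by the route's own second
# crux `PlusMCEtaK` (19501) and its named-fact item `SignedReadingFacts` (19502) through k8i-c2's (K)-form converse; Gross–Zagier
# I.(7.3), Mazur's Manin-constant theorem and the separate entire-`L` input leave as in Part 57 — the composition heads for a
# v10 `kato_perrin_riou_istar` skeleton (seat `bsd-cm-prr-ty1` g21, cell `bsd-cm`; theorems only: no definition, no named fact,
# no instance, no `sorry`; this file registers nothing — the planner touches the skeleton)

Part 58 of the seat's kernel cut (crux stmt-BirchSwinnertonDyer-19223, registered line `kato_perrin_riou_istar` v8, drafts v9;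
companion of Part 57 `KatoDescentKMCImpReadingIstarNamedInputs.lean`, which keeps `PrintReadingsInert` and cuts only `PublishedFactsInert`).

LEAF AUDIT (the istar PURE-CITE stub 6 `stub_printInputsInert : PrintReadingsInert ∧ PublishedFactsInert`, v4–v9).
* `PrintReadingsInert` is the route item 19226 — on the ledger an ASIDE («aside r9, auto-flagged conjecture-grade; OUT OF THE CONE of
  closes v2», refuter note 2026-08-27; planner bsd-cm-plan D92: retired in favour of `PlusMCEtaK` + `SignedReadingFacts`): never
  staffed, never closed.  Its FIRST conjunct is the `ℚ(√p*)`-form plus main conjecture (C1_η) `∀ p ≥ 5, ∀ V CM good CM-inert,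
  Additive.QuadraticBranchPlusMainConjectureAt V p` (an `@[conjecture]` predicate; Pollack–Rubin 2004 p. 448 prints only a remark),
  which every in-tree derivation of `PrintReadingsInert` takes as a HYPOTHESIS (`PrintReadingsOfLiterature.printReadingsInert_of_plusMCEtaCM
  (hKO) (h74) (hC1) (hC1K)`, `…_of_plusMC_of_h74X (hKO) (hC1) (h74X)`) and which is NOT a consequence of the route's rev-4 crux
  `PlusMCEtaK` (Kobayashi's `K_∞`-form at `η`, a different object).  The v4–v9 istar head consumes it GENUINELY: Part 50 §2 / Part 55 §1
  end in bsd-cm-inert's `CccOneLowerHalf.cccOneLawOnTypeIstarZero_of_bsdpOnType h₅ hmod hGZK hPT hB`, whose proof feeds `hC1 V hCM hgood hin`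
  into the `h1 : QuadraticBranchPlusMainConjectureAt V p` slot of `quadraticBranchPAdicGrossZagierValuationAt_of_bsdp_of_readings`.  So a
  by-name closure of 19223 through the registered line would need, besides its research stubs, a conjecture-grade input that the route
  of record has RETIRED and nobody attacks.
* The CONVERSE «`BSD_p` on the type ⟹ crux» exists in the tree WITHOUT that input: k8i-c2 g4's
  `CccOneKFormConverse.cccOneLawOnTypeIstarZero_of_bsdpOnType_of_plusMCEtaK (hmod) (hGZK) (hPT) (hKO) (h74) (hK) (hB)`
  (`Theorems/InertBadSignedBranchesCccOneLawOnTypeIstarZeroOfBSDpKForm.lean` §3: the (F)-free exact reading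
  `exactReadingAt_of_kobayashi74_of_plusMCEtaK`, (R2) by `oddBranchStrictMinusNoFiniteSubmoduleAt_of_kitajimaOtsuki`), with `hK` = the route
  crux `PlusMCEtaK` (19501) VERBATIM and `(hKO, h74)` = the two conjuncts of `SignedReadingFacts` (19502: Kitajima–Otsuki Main Thm. 1.3 at
  `η` ∧ Kobayashi Thm. 7.4 at `η`, both named Literature facts; glue 19520 closed).  Its §5 re-based k8i-c2's OLD Kato–Perrin-Riou road
  (generic `TorsionFree.RankOneCountReading` / `RealizableOfKMC` over the potss interface) on these items; the registered skeleton's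
  ROW-KEYED, GZK-guarded heads (Parts 50/55) were never re-based — this file does it.
* `PublishedFactsInert` (19227) is cut exactly as in Part 57: the line consumes `hasEntireLFunction_rat` (⟸ `exists_isNewformOf`,
  `WeierstrassCurve.hasEntireLFunction_rat_of_exists_isNewformOf`, Diamond–Shurman 8.8.3), GZK and Poitou–Tate; Gross–Zagier I.(7.3),
  Mazur 1978 and the item's own modularity conjunct are not consumed.
REPLACEMENT (tree theorems only): the heads below take `(hK : PlusMCEtaK) (hR : SignedReadingFacts) (hnf : exists_isNewformOf) (hGZK) (hPT)`
in place of `(h₅ : PrintReadingsInert) (h₆ : PublishedFactsInert)`, every OTHER binder type BYTE-IDENTICAL to Part 55's (so the registered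
`rowCount_closed` / `realizable_closed` / `kmcFine_closed` / `stub_perrinRiouRatioIstarZero` feed them unchanged).
HEADS.  §1 (interface binders) `cccOneLawOnTypeIstarZero_of_rowCount_of_rowRealizable_of_perrinRiou_of_plusMCEtaK (hCrows) (hrealRows) (hread)
(hKMC) (hPR) (hK) (hR) (hnf) (hGZK) (hPT)`; §2 (closed triple, GZK-guarded) ★★★
`cccOneLawOnTypeIstarZero_of_rowCountOfGZK_of_rowRealizableOfGZK_of_kmcFineContra_of_perrinRiouRatio_of_plusMCEtaK (hCrows) (hrealRows) (hKMC)
(hPR) (hK) (hR) (hnf) (hGZK) (hPT)` = THE v10 COMPOSITION HEAD on the route of record.  v10 (planner's touch, if taken): stub 6 becomes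
`stub_routeInputsInert : PlusMCEtaK ∧ SignedReadingFacts ∧ rank_eq_analyticRank_of_analyticRank_le_one ∧ poitouTate_selmerStructure_duality_real ℚ`
(BY NAME: the route's crux 19501 — which the rung leaf bridge 19503 `InertBadOddEta.cmInertBad_of_cccOne_of_kobayashi74_of_plusMCEtaK` consumes
ANYWAY next to 19223 —, its named-fact item 19502, and two named facts), composition `:= <§2 head> rowCount_closed realizable_closed
(kmcFine_closed ·) (stub_perrinRiouRatioIstarZero ·) stub6.1 stub6.2.1 stub_printFactsKato.2.1 stub6.2.2.1 stub6.2.2.2`.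
READING OF RECORD it yields (19223 via the KPR line): RESEARCH {PR^× on the rows, μ-equality at (p)} ∪ ROUTE CRUX {`PlusMCEtaK` (19501) =
print up to μ (19866 CLOSED from Burungale–Tian Thm. 2.6 at `η` + Kobayashi Thm. 2.2, items 19867) + its μ-part 19865 (research)} ∪ PRINT
{H2X′, `exists_isNewformOf`, F-CM, BT26 Thm. 2.6, Kitajima–Otsuki 1.3, Kobayashi 7.4, GZK, Poitou–Tate}: for the rung «19223 → X12.CMInertBad»
the line then adds NO conjecture-grade input beyond its own research stubs (the rung carries 19501 already); (C1_η) in `ℚ(√p*)`-form,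
(R2)-as-conjecture, GZ I.(7.3), Mazur–Manin and `hasEntireLFunction_rat` are OUT of this cone (they stay the tree's declarations, unused here).
HONEST LABEL: every statement is CONDITIONAL on displayed hypotheses; `PlusMCEtaK` is conjecture-grade (its μ-part is open in print,
Burungale–Tian Rem. 2.7); the crux is concluded BY NAME, never restated; 19223 and 19501 stay OPEN; no stub is closed on the ledger;
X12.CMInertBad is NOT proved; no summit statement is proved by this seat; BSD is not proved for any curve.
[cite: Kobayashi2003, §4 (p. 8), Thm. 2.2, Thm. 7.4 (p. 13), Thm. 9.3 (p. 26)] [cite: KitajimaOtsuki2018, Main Thm. 1.3 (arXiv:1607.03612 p. 3)]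
[cite: PollackRubin2004, Theorem and the remark on Sel over ℚ(μ_{p^∞}) (p. 448)] [cite: BurungaleTian2026, Thm. 2.6, Rem. 2.7 (p. 5)]
[cite: BurnsKuriharaSano2019, Thm. 7.3 and Thm. 7.6 (p. 29), Conj. 2.8 (p. 10)] [cite: Kato2004Asterisque, Conj. 12.10 (p. 224), §14.14 (p. 243)]
[cite: DiamondShurman2005, Thm. 8.8.3] [cite: Miller2011LMS, §1 and Def. 1.1]
-/

noncomputable section

open scoped Classical NumberField

open WeierstrassCurve Literature.NumberTheory.EllipticCurves
  Literature.NumberTheory.EllipticCurves.ModularForms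
  Literature.NumberTheory.EllipticCurves.Rank1Residual
  Literature.NumberTheory.EllipticCurves.Rank1Residual.Typed
  Literature.NumberTheory.EllipticCurves.IwasawaAlgebra
  Literature.NumberTheory.GaloisCohomology
open Summit.BirchSwinnertonDyer.Rank1Residual
open Summit.BirchSwinnertonDyer.Rank1Residual.Additive
open Summit.BirchSwinnertonDyer.Rank1Residual.X12.O10
open Summit.BirchSwinnertonDyer.BirchSwinnertonDyer.Theses.InertBadSignedBranches
open Summit.BirchSwinnertonDyer.BirchSwinnertonDyer.Theorems

namespace Summit.BirchSwinnertonDyer.Rank1Residual.Additive.KMCImpReadingPointwise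

/-! ## §1 Crux 19223 BY NAME from a row-keyed count AND a row-keyed realisation, over the interface binders, on the
route's rev-4 items `PlusMCEtaK` / `SignedReadingFacts` and the named facts (modularity, GZK, Poitou–Tate) -/

section RowKeyed

variable {IsOf : ∀ (W : WeierstrassCurve ℚ) [W.IsElliptic] [W.IsGloballyMinimal] (p : ℕ) [Fact p.Prime],
  KatoDescentDatum p → Prop}
variable {PRRatio : ∀ (W : WeierstrassCurve ℚ) [W.IsElliptic] [W.IsGloballyMinimal] (p : ℕ)
  [Fact p.Prime], ℚ_[p] → Prop}
variable {KMC : ∀ (W : WeierstrassCurve ℚ) [W.IsElliptic] [W.IsGloballyMinimal] (p : ℕ), Prop}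

/-- **Crux 19223 `CccOneLawOnTypeIstarZero` ⟸ KMC(T_pW) ∧ PR^×(W, p) at every rank-one pair of the type `(p, I₀*)`, `p ≥ 5`, count AND
realisation keyed TO THE ROWS, ON THE ROUTE'S rev-4 ITEMS** — Part 55 §1
`cccOneLawOnTypeIstarZero_of_rowCount_of_rowRealizable_of_perrinRiou` with `(h₅ : PrintReadingsInert) (h₆ : PublishedFactsInert)` replaced by
the route crux `hK : PlusMCEtaK`, its named-fact item `hR : SignedReadingFacts`, modularity `hnf` (entire `L` by
`hasEntireLFunction_rat_of_exists_isNewformOf`), GZK `hGZK` and Poitou–Tate `hPT`; every other binder type identical.  Per pair: Part 50 §1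
`rankOne_bsdp_of_countAt`, then k8i-c2's (K)-form converse `CccOneKFormConverse.cccOneLawOnTypeIstarZero_of_bsdpOnType_of_plusMCEtaK` (no
`ℚ(√p*)`-form (C1_η)).  The crux is concluded BY NAME.  CONDITIONAL; 19223 stays OPEN.
[cite: BurnsKuriharaSano2019, Thm. 7.6 (p. 29)] [cite: Kato2004Asterisque, Conj. 12.10 (p. 224), §15]
[cite: Kobayashi2003, §4 (p. 8), Thm. 7.4 (p. 13)] [cite: KitajimaOtsuki2018, Main Thm. 1.3 (arXiv:1607.03612 p. 3)] [cite: DiamondShurman2005, Thm. 8.8.3] -/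
theorem cccOneLawOnTypeIstarZero_of_rowCount_of_rowRealizable_of_perrinRiou_of_plusMCEtaK
    (hCrows : ∀ (p : ℕ) [Fact p.Prime], 5 ≤ p → ∀ (W : WeierstrassCurve ℚ) [W.IsElliptic] [W.IsGloballyMinimal],
      HasSignedLocalType W p (.Istar 0) → W.analyticRank = 1 →
      ∀ (D : KatoDescentDatum p) (ℒ : ℚ_[p]), IsOf W p D → PRRatio W p ℒ →
        Finite (coinvariants p D.H2) ∧ (ℒ ≠ 0 ↔ D.zetaIndex ≠ 0) ∧
          ∀ m : ℕ, D.zetaIndex = p ^ m * D.h2Card →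
            ℒ.valuation = (m : ℤ) +
              padicValNat p (Nat.card (AddCommGroup.primaryComponent W.sha p)) +
              padicValNat p W.tamagawaProduct)
    (hrealRows : ∀ (p : ℕ) [Fact p.Prime], 5 ≤ p → ∀ (W : WeierstrassCurve ℚ) [W.IsElliptic] [W.IsGloballyMinimal],
      HasSignedLocalType W p (.Istar 0) → W.analyticRank = 1 → KMC W p → ∃ D : KatoDescentDatum p, IsOf W p D)
    (hread : ∀ (W : WeierstrassCurve ℚ) [W.IsElliptic] [W.IsGloballyMinimal] (p : ℕ) [Fact p.Prime]
      (D : KatoDescentDatum p), IsOf W p D → KMC W p → D.Conj1210)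
    (hKMC : ∀ (p : ℕ) [Fact p.Prime], 5 ≤ p → ∀ (W : WeierstrassCurve ℚ) [W.IsElliptic]
      [W.IsGloballyMinimal], HasSignedLocalType W p (.Istar 0) → W.analyticRank = 1 → KMC W p)
    (hPR : ∀ (p : ℕ) [Fact p.Prime], 5 ≤ p → ∀ (W : WeierstrassCurve ℚ) [W.IsElliptic]
      [W.IsGloballyMinimal], HasSignedLocalType W p (.Istar 0) → W.analyticRank = 1 →
      PerrinRiouUpToUnitAt PRRatio W p)
    (hK : PlusMCEtaK) (hR : SignedReadingFacts) (hnf : exists_isNewformOf)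
    (hGZK : rank_eq_analyticRank_of_analyticRank_le_one) (hPT : poitouTate_selmerStructure_duality_real ℚ) :
    CccOneLawOnTypeIstarZero := by
  have hmod : hasEntireLFunction_rat := hasEntireLFunction_rat_of_exists_isNewformOf hnf
  refine CccOneKFormConverse.cccOneLawOnTypeIstarZero_of_bsdpOnType_of_plusMCEtaK hmod hGZK hPT hR.1 hR.2 hK
    fun p _ hp5 W _ _ hT hr ↦ ?_
  obtain ⟨-, -, htors⟩ :=
    CccOneKMCPerrinRiou.addv_and_j_nonneg_and_not_dvd_torsionOrder_of_hasSignedLocalType W p (by omega) hT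
  exact rankOne_bsdp_of_countAt W p (hCrows p hp5 W hT hr) (fun hK' ↦ hrealRows p hp5 W hT hr hK') hread hGZK hmod hr htors
    (hPR p hp5 W hT hr) (hKMC p hp5 W hT hr)

end RowKeyed

/-! ## §2 At the PRINT-EXACT closed triple, GZK-guarded: the v10 composition head on the route of record -/

section Closed

/-- ★★★ **Crux 19223 BY NAME from a ROW-KEYED stub 3 and a ROW-KEYED stub 4, both GUARDED BY GZK, on the route's rev-4 items** —
Part 55 ★ `cccOneLawOnTypeIstarZero_of_rowCountOfGZK_of_rowRealizableOfGZK_of_kmcFineContra_of_perrinRiouRatio` with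
`(h₅ : PrintReadingsInert) (h₆ : PublishedFactsInert)` replaced by `(hK : PlusMCEtaK) (hR : SignedReadingFacts) (hnf : exists_isNewformOf) (hGZK)
(hPT)`; `hCrows`, `hrealRows`, `hKMC`, `hPR` BYTE-IDENTICAL to Part 55's (= the registered `rowCount_closed` / `realizable_closed` /
`kmcFine_closed` / `stub_perrinRiouRatioIstarZero` types); the `→`-only reading discharged by
`conj1210_of_isKatoZetaDescentDatumOfContra_of_katoMainConjectureFineContra` (p628155).  Intended as the composition term of a v10 istar
skeleton whose stub 6 reads `PlusMCEtaK ∧ SignedReadingFacts ∧ rank_eq_analyticRank_of_analyticRank_le_one ∧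
poitouTate_selmerStructure_duality_real ℚ` (this file registers nothing).  CONDITIONAL; 19223 / 19501 stay OPEN; BSD is not proved.
[cite: BurnsKuriharaSano2019, Thm. 7.6 (p. 29), Conj. 2.8 (ii) (p. 10)] [cite: Kato2004Asterisque, Conj. 12.10 (p. 224), §14.14 (p. 243)]
[cite: Kobayashi2003, §4 (p. 8), Thm. 7.4 (p. 13)] [cite: KitajimaOtsuki2018, Main Thm. 1.3 (arXiv:1607.03612 p. 3)] [cite: DiamondShurman2005, Thm. 8.8.3] -/
theorem cccOneLawOnTypeIstarZero_of_rowCountOfGZK_of_rowRealizableOfGZK_of_kmcFineContra_of_perrinRiouRatio_of_plusMCEtaK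
    (hCrows : rank_eq_analyticRank_of_analyticRank_le_one →
      ∀ (p : ℕ) [Fact p.Prime], 5 ≤ p → ∀ (W : WeierstrassCurve ℚ) [W.IsElliptic] [W.IsGloballyMinimal],
      HasSignedLocalType W p (.Istar 0) → W.analyticRank = 1 →
      ∀ (D : KatoDescentDatum p) (ℒ : ℚ_[p]),
        IsKatoZetaDescentDatumOfContra W p D → Kato2004.PRRatio W p ℒ →
        Finite (coinvariants p D.H2) ∧ (ℒ ≠ 0 ↔ D.zetaIndex ≠ 0) ∧
          ∀ m : ℕ, D.zetaIndex = p ^ m * D.h2Card →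
            ℒ.valuation = (m : ℤ) +
              padicValNat p (Nat.card (AddCommGroup.primaryComponent W.sha p)) +
              padicValNat p W.tamagawaProduct)
    (hrealRows : rank_eq_analyticRank_of_analyticRank_le_one →
      ∀ (p : ℕ) [Fact p.Prime], 5 ≤ p → ∀ (W : WeierstrassCurve ℚ) [W.IsElliptic] [W.IsGloballyMinimal],
      HasSignedLocalType W p (.Istar 0) → W.analyticRank = 1 →
      KatoMainConjectureFineContra W p → ∃ D : KatoDescentDatum p, IsKatoZetaDescentDatumOfContra W p D)
    (hKMC : ∀ (p : ℕ) [Fact p.Prime], 5 ≤ p → ∀ (W : WeierstrassCurve ℚ) [W.IsElliptic]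
      [W.IsGloballyMinimal], HasSignedLocalType W p (.Istar 0) → W.analyticRank = 1 →
      KatoMainConjectureFineContra W p)
    (hPR : ∀ (p : ℕ) [Fact p.Prime], 5 ≤ p → ∀ (W : WeierstrassCurve ℚ) [W.IsElliptic]
      [W.IsGloballyMinimal], HasSignedLocalType W p (.Istar 0) → W.analyticRank = 1 →
      PerrinRiouUpToUnitAt Kato2004.PRRatio W p)
    (hK : PlusMCEtaK) (hR : SignedReadingFacts) (hnf : exists_isNewformOf)
    (hGZK : rank_eq_analyticRank_of_analyticRank_le_one) (hPT : poitouTate_selmerStructure_duality_real ℚ) :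
    CccOneLawOnTypeIstarZero :=
  cccOneLawOnTypeIstarZero_of_rowCount_of_rowRealizable_of_perrinRiou_of_plusMCEtaK (hCrows hGZK) (hrealRows hGZK)
    (fun _ _ _ _ _ _ hD hK' ↦ conj1210_of_isKatoZetaDescentDatumOfContra_of_katoMainConjectureFineContra hD hK')
    hKMC hPR hK hR hnf hGZK hPT

end Closed

end Summit.BirchSwinnertonDyer.Rank1Residual.Additive.KMCImpReadingPointwise

end
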